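import Literature.Barriers.NavierStokesRegularity.CriticalDataSmoothNonuniquenessConstruction
import Literature.Barriers.NavierStokesRegularity.CriticalDataSmoothNonuniquenessGlobal
import HarnessLib

/-!
# Coiculescu–Palasek 2025, Thm. 1.2: the §5 assembly re-proved over the CORRECTED perturbation
  step (Hölder exponent below a threshold), as an explicit hypothesis

Sibling proof file of the barrier entry
`Literature/Barriers/NavierStokesRegularity/CriticalDataSmoothNonuniqueness` (D-0021; M. P.
Coiculescu, S. Palasek, *Non-uniqueness of smooth solutions of the Navier–Stokes equations from
critical data*, Invent. Math. 244 (2025), 165–219, arXiv:2503.14699, Thm. 1.2 with Rmk. 1.3).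

State of the proof architecture in the tree (files `…Proofs`, `…Construction`, `…Global`,
`…Assembly`, `…PerturbationRefuted`):

* `CriticalDataSmoothNonuniqueness_of_parts` — finite-time construction (explicit) and the
  small-data global extension imply the barrier fact; the extension is DISCHARGED
  (`CoiculescuPalasek2025_globalExtension_holds`);
* `CoiculescuPalasek2025_construction_of_parts hA hB` — the finite-time construction from the
  principal parts with their residuals (`hA`, explicit: Def. 3.10, Prop. 3.13, Prop. 4.1 and the
  `v⁽ⁱ⁾`-only estimates of §5) and the perturbation theorem `hB = CoiculescuPalasek2025_perturbation`
  (Props. 4.2–4.3 abstracted to ALL Hölder exponents `κ ∈ (0, 1/2 - 4α)`);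
* `not_CoiculescuPalasek2025_perturbation` — that abstraction is FALSE (a forced shear flow; the
  printed proof of Prop. 4.2 carries the weight `t^{-(1+κ)/2}` on the `Ċ^{1,κ}` slot of the
  semigroup, with which the fixed point of Prop. 4.3 closes in `X` only for `κ ≤ α`; the paper is
  unaffected because its `κ` is at the authors' disposal, see the correction section of
  `…Construction` and the module docstring of `…PerturbationRefuted`).

So the only assembly in the tree currently runs through a refuted hypothesis. This file restores
a sound seam WITHOUT minting a named fact (D-0026: the perturbation step is a slice of the proof of
Thm. 1.2, hence an explicit hypothesis, exactly as the principal parts `hA` are): the perturbation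
step is demanded only for Hölder exponents BELOW A THRESHOLD `κ₁ = κ₁(α, K, C) > 0` — the form the
printed proof supports (Prop. 4.3 with Prop. 4.2 as proved: any `κ ≤ α` will do, so `κ₁ = α` is a
witness; §2.4/§4.1: "`κ` … chosen to lie in explicit intervals depending on `b, α, γ`", only upper
bounds on `κ` being used) — and only with the five conclusions the assembly consumes (classical
solution `v + w`, zero mean of `w`, the `L^∞` slot `t^{(1-α)/2}‖w‖ ≤ ε₁` of `‖w‖_X ≤ ε₁`,
`‖w(t)‖_{Ḣ^{-1}} → 0`, pairings `→ 0`; the `Ċ^{1,κ}` slot of `‖w‖_X ≤ ε₁` is internal to the fixed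
point and is not asked for). The principal parts `hA` produce SOME admissible `κ₀`; since the
hypothesis bundle `IsApproximateSolution` is monotone under decreasing the exponent
(`IsApproximateSolution.of_exponent_le`, `…Construction`), the assembly runs at `κ = min κ₀ κ₁`.

Proved here:

* `CoiculescuPalasek2025.construction_of_parts_at` — the §5 assembly below the seam at FIXED
  exponents `(α, κ)` and constants `(K, C)`: the principal-parts conclusion at these parameters and
  the perturbation conclusion at these parameters give the finite-time construction (the Lean
  content is that of `CoiculescuPalasek2025_construction_of_parts`, now for any `α > 0`);
* `CoiculescuPalasek2025_construction_of_parts_of_threshold` — principal parts (`hA`, verbatim the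
  hypothesis of `CoiculescuPalasek2025_construction_of_parts`) and the threshold form of the
  perturbation step imply the finite-time construction (verbatim the hypothesis `h₁` of
  `CriticalDataSmoothNonuniqueness_of_parts`);
* `CriticalDataSmoothNonuniqueness_of_principalParts_of_perturbationThreshold` and
  `CriticalDataSmoothNonuniqueness_of_principalParts_of_perturbationLe` — the barrier fact from
  the principal parts and the corrected perturbation step, in the threshold form and in the
  `κ ≤ α` form of the correction section of `…Construction`.

What remains between the tree and `CriticalDataSmoothNonuniqueness` after this file: the two
explicit hypotheses `hA` (the whole of §3 with Prop. 4.1: SIZE XL) and the corrected perturbation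
step (Props. 4.2–4.3 with App. B for small `κ`), both proof obligations of the barrier's own
seats, neither a named fact.

## References

* M. P. Coiculescu, S. Palasek, Invent. Math. 244 (2025), 165–219,
  doi:10.1007/s00222-025-01396-z, arXiv:2503.14699: §2.4 (parameters), §4.1 (range of `κ`),
  Prop. 4.2 and its proof (the weight `t^{(1+κ)/2}` in the `Ċ^{1,κ}` Grönwall step), Prop. 4.3,
  §5 (proof of Thm. 1.2). [`CoiculescuPalasek2025`]
-/

noncomputable section

open MeasureTheory Set Filter
open _root_.Topology
open scoped InnerProductSpace RealInnerProductSpace NNReal ENNReal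

namespace Literature.Barriers.NavierStokesRegularity

open Literature.Analysis.FunctionSpaces CoiculescuPalasek2025

/-! ## The §5 assembly below the seam at fixed exponents -/

/-- **§5 of Coiculescu–Palasek 2025 below the seam, at fixed parameters.** Fix a subcriticality
exponent `α > 0`, a Hölder exponent `κ` and constants `K, C`. Suppose (`hA`) that for all
targets `ε₀, η, δ > 0`, `L` there are two approximate solutions on `(0, T_*]` with data
`(α, κ, K, C, η, ε₀)` (`CoiculescuPalasek2025.IsApproximateSolution`: Def. 3.10, Prop. 3.13,
eq. (4.1), Prop. 4.1), distinct with margin `L` at some `t₀`, with a common datum in the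
`Ḣ^{-1}`/pairing sense and of sup norm `≤ δ` at `T_*` (the `v⁽ⁱ⁾`-only estimates of §5), and (`hB`)
that the perturbation step holds at these parameters: some `C₄ > 0` such that for every
`ε₁ ∈ (0, C₄⁻¹)` some `ε₀, η > 0` make every such approximate solution `(v, F, π)` correctable by a
mean-zero `w` with `v + w` a classical solution of the unforced equations on `(0, T_*]`,
`t^{(1-α)/2}‖w(t,x)‖ ≤ ε₁`, `‖w(t)‖_{Ḣ^{-1}} → 0` and `∫⟪w(t), φ⟫ → 0` for smooth mean-zero `φ`
(Props. 4.2–4.3 with the first paragraph of §5, `L^∞` slot of `B_X(0, ε₁)` only). Then the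
finite-time construction holds (verbatim the hypothesis `h₁` of
`CriticalDataSmoothNonuniqueness_of_parts`). Proof as in `CoiculescuPalasek2025_construction_of_parts`
(the rest of §5): given `ε`, put `ε₁ = min (C₄⁻¹/2) (ε/2 · T_*^{(1-α)/2})`, take `ε₀, η`, run `hA`
with margin `3ε₁` and final smallness `ε/2`, perturb both parts; Koch–Tataru bound `|K 0| + ε₁`
(`√t = t^{α/2} t^{(1-α)/2}`, `t ≤ T_* ≤ 1`), distinctness by `3ε₁ > 2ε₁`, datum clauses by the
triangle inequality in `Ḣ^{-1}` and additivity of pairings, zero mean and smallness at `T_*` by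
additivity. [cite: CoiculescuPalasek2025, §5 (proof of Thm. 1.2) with Props. 3.13, 4.1, 4.3] -/
theorem CoiculescuPalasek2025.construction_of_parts_at {α : ℝ} (hα : 0 < α)
    {κ : ℝ≥0} {K : ℕ → ℝ} {C : ℝ}
    (hA : ∀ (ε₀ η L δ : ℝ), 0 < ε₀ → 0 < η → 0 < δ →
      ∃ (v₁ v₂ : ℝ → UnitAddTorus (Fin 3) → EuclideanSpace ℝ (Fin 3))
        (F₁ F₂ : ℝ → UnitAddTorus (Fin 3) → (Fin 3 → Fin 3 → ℝ))
        (π₁ π₂ : ℝ → UnitAddTorus (Fin 3) → ℝ),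
        IsApproximateSolution unitTime α κ K C η ε₀ v₁ F₁ π₁ ∧
        IsApproximateSolution unitTime α κ K C η ε₀ v₂ F₂ π₂ ∧
        (∃ t₀ ∈ Ioc (0 : ℝ) unitTime, ∃ x₀ : UnitAddTorus (Fin 3),
          L ≤ t₀ ^ ((1 - α) / 2) * ‖v₁ t₀ x₀ - v₂ t₀ x₀‖) ∧
        Tendsto (fun t =>
            Torus.eHomSobolevSeminorm (-1) (EuclideanSpace.complexify ∘ (v₁ t - v₂ t)))
          (𝓝[>] 0) (𝓝 0) ∧
        Tendsto (fun st : ℝ × ℝ =>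
            Torus.eHomSobolevSeminorm (-1) (EuclideanSpace.complexify ∘ (v₁ st.1 - v₁ st.2)))
          ((𝓝[>] (0 : ℝ)) ×ˢ (𝓝[>] (0 : ℝ))) (𝓝 0) ∧
        Tendsto (fun st : ℝ × ℝ =>
            Torus.eHomSobolevSeminorm (-1) (EuclideanSpace.complexify ∘ (v₂ st.1 - v₂ st.2)))
          ((𝓝[>] (0 : ℝ)) ×ˢ (𝓝[>] (0 : ℝ))) (𝓝 0) ∧
        (∀ φ : UnitAddTorus (Fin 3) → EuclideanSpace ℝ (Fin 3), Torus.IsSmooth φ →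
          Torus.HasZeroMean φ →
          ∃ c : ℝ, Tendsto (fun t => ∫ x, ⟪v₁ t x, φ x⟫) (𝓝[>] 0) (𝓝 c) ∧
            Tendsto (fun t => ∫ x, ⟪v₂ t x, φ x⟫) (𝓝[>] 0) (𝓝 c)) ∧
        (∀ x, ‖v₁ unitTime x‖ ≤ δ ∧ ‖v₂ unitTime x‖ ≤ δ))
    (hB : ∃ C₄ : ℝ, 0 < C₄ ∧
      ∀ ε₁ : ℝ, 0 < ε₁ → ε₁ < C₄⁻¹ →
      ∃ ε₀ : ℝ, 0 < ε₀ ∧ ∃ η : ℝ, 0 < η ∧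
      ∀ (v : ℝ → UnitAddTorus (Fin 3) → EuclideanSpace ℝ (Fin 3))
        (F : ℝ → UnitAddTorus (Fin 3) → (Fin 3 → Fin 3 → ℝ)) (π : ℝ → UnitAddTorus (Fin 3) → ℝ),
        IsApproximateSolution unitTime α κ K C η ε₀ v F π →
        ∃ (w : ℝ → UnitAddTorus (Fin 3) → EuclideanSpace ℝ (Fin 3))
          (q : ℝ → UnitAddTorus (Fin 3) → ℝ),
          Torus.IsClassicalNSSolutionOn (Ioc 0 unitTime) 1 0 (v + w) q ∧
          (∀ t ∈ Ioc (0 : ℝ) unitTime, Torus.HasZeroMean (w t)) ∧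
          (∀ t ∈ Ioc (0 : ℝ) unitTime, ∀ x, t ^ ((1 - α) / 2) * ‖w t x‖ ≤ ε₁) ∧
          Tendsto (fun t => Torus.eHomSobolevSeminorm (-1) (EuclideanSpace.complexify ∘ w t))
            (𝓝[>] 0) (𝓝 0) ∧
          ∀ φ : UnitAddTorus (Fin 3) → EuclideanSpace ℝ (Fin 3), Torus.IsSmooth φ →
            Torus.HasZeroMean φ → Tendsto (fun t => ∫ x, ⟪w t x, φ x⟫) (𝓝[>] 0) (𝓝 0)) :
    ∀ ε : ℝ, 0 < ε →
      ∃ T : ℝ, 0 < T ∧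
      ∃ (u v : ℝ → UnitAddTorus (Fin 3) → EuclideanSpace ℝ (Fin 3))
        (p₁ p₂ : ℝ → UnitAddTorus (Fin 3) → ℝ),
        Torus.IsClassicalNSSolutionOn (Ioc 0 T) 1 0 u p₁ ∧
        Torus.IsClassicalNSSolutionOn (Ioc 0 T) 1 0 v p₂ ∧
        (∃ M : ℝ, ∀ t ∈ Ioc (0 : ℝ) T, ∀ x,
          Real.sqrt t * ‖u t x‖ ≤ M ∧ Real.sqrt t * ‖v t x‖ ≤ M) ∧
        (∃ t₀ ∈ Ioc (0 : ℝ) T, u t₀ ≠ v t₀) ∧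
        Tendsto (fun t =>
            Torus.eHomSobolevSeminorm (-1) (EuclideanSpace.complexify ∘ (u t - v t)))
          (𝓝[>] 0) (𝓝 0) ∧
        Tendsto (fun st : ℝ × ℝ =>
            Torus.eHomSobolevSeminorm (-1) (EuclideanSpace.complexify ∘ (u st.1 - u st.2)))
          ((𝓝[>] (0 : ℝ)) ×ˢ (𝓝[>] (0 : ℝ))) (𝓝 0) ∧
        Tendsto (fun st : ℝ × ℝ =>
            Torus.eHomSobolevSeminorm (-1) (EuclideanSpace.complexify ∘ (v st.1 - v st.2)))
          ((𝓝[>] (0 : ℝ)) ×ˢ (𝓝[>] (0 : ℝ))) (𝓝 0) ∧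
        (∀ φ : UnitAddTorus (Fin 3) → EuclideanSpace ℝ (Fin 3),
          Torus.IsSmooth φ → Torus.HasZeroMean φ →
          (∃ c : ℝ, Tendsto (fun t => ∫ x, ⟪u t x, φ x⟫) (𝓝[>] 0) (𝓝 c)) ∧
          (∃ c : ℝ, Tendsto (fun t => ∫ x, ⟪v t x, φ x⟫) (𝓝[>] 0) (𝓝 c)) ∧
          Tendsto (fun t => ∫ x, ⟪u t x - v t x, φ x⟫) (𝓝[>] 0) (𝓝 0)) ∧
        Torus.HasZeroMean (u T) ∧ Torus.HasZeroMean (v T) ∧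
        (∀ x, ‖u T x‖ ≤ ε ∧ ‖v T x‖ ≤ ε) := by
  intro ε hε
  -- parameters: `C₄` (`hB`), `ε₁`, then `ε₀, η` (`hB`)
  obtain ⟨C₄, hC₄, hB⟩ := hB
  have hT0 : 0 < unitTime := unitTime_pos
  have hT1 : unitTime ≤ 1 := unitTime_le_one
  have hTmem : unitTime ∈ Ioc (0 : ℝ) unitTime := ⟨hT0, le_rfl⟩
  obtain ⟨c, hc⟩ : ∃ c : ℝ, c = unitTime ^ ((1 - α) / 2) := ⟨_, rfl⟩
  have hc0 : 0 < c := hc ▸ Real.rpow_pos_of_pos hT0 _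
  have hC₄' : 0 < C₄⁻¹ := inv_pos.2 hC₄
  obtain ⟨ε₁, hε₁⟩ : ∃ ε₁ : ℝ, ε₁ = min (C₄⁻¹ / 2) (ε / 2 * c) := ⟨_, rfl⟩
  have hε₁0 : 0 < ε₁ := hε₁ ▸ lt_min (half_pos hC₄') (mul_pos (half_pos hε) hc0)
  have hε₁1 : ε₁ < C₄⁻¹ := hε₁ ▸ (min_le_left _ _).trans_lt (half_lt_self hC₄')
  have hε₁2 : ε₁ ≤ ε / 2 * c := hε₁ ▸ min_le_right _ _
  obtain ⟨ε₀, hε₀, η, hη, hB⟩ := hB ε₁ hε₁0 hε₁1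
  obtain ⟨v₁, v₂, F₁, F₂, π₁, π₂, h₁, h₂, ⟨t₀, ht₀, x₀, hdist⟩, hdat, hc₁, hc₂, hφ, hδ⟩ :=
    hA ε₀ η (3 * ε₁) (ε / 2) hε₀ hη (half_pos hε)
  obtain ⟨w₁, q₁, hu₁, hm₁, hw₁, hH₁, hP₁⟩ := hB v₁ F₁ π₁ h₁
  obtain ⟨w₂, q₂, hu₂, hm₂, hw₂, hH₂, hP₂⟩ := hB v₂ F₂ π₂ h₂
  -- continuity of all slices on `(0, T_*]`
  have hv₁c : ∀ t ∈ Ioc (0 : ℝ) unitTime, Continuous (v₁ t) := fun t ht => h₁.continuous_slice ht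
  have hv₂c : ∀ t ∈ Ioc (0 : ℝ) unitTime, Continuous (v₂ t) := fun t ht => h₂.continuous_slice ht
  have hw₁c : ∀ t ∈ Ioc (0 : ℝ) unitTime, Continuous (w₁ t) := fun t ht => by
    have h := ((hu₁.smooth_velocity.isSmooth_slice ht).continuous).sub (hv₁c t ht)
    rwa [Pi.add_apply, add_sub_cancel_left] at h
  have hw₂c : ∀ t ∈ Ioc (0 : ℝ) unitTime, Continuous (w₂ t) := fun t ht => by
    have h := ((hu₂.smooth_velocity.isSmooth_slice ht).continuous).sub (hv₂c t ht)
    rwa [Pi.add_apply, add_sub_cancel_left] at h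
  -- the sup-norm slot of `‖wᵢ‖_X ≤ ε₁`, in the two forms used below
  have hwKT : ∀ {w : ℝ → UnitAddTorus (Fin 3) → EuclideanSpace ℝ (Fin 3)},
      (∀ t ∈ Ioc (0 : ℝ) unitTime, ∀ x, t ^ ((1 - α) / 2) * ‖w t x‖ ≤ ε₁) →
      ∀ t ∈ Ioc (0 : ℝ) unitTime, ∀ x, Real.sqrt t * ‖w t x‖ ≤ ε₁ := by
    intro w hw t ht x
    have hsplit : Real.sqrt t = t ^ (α / 2) * t ^ ((1 - α) / 2) := by
      rw [Real.sqrt_eq_rpow, ← Real.rpow_add ht.1]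
      congr 1
      ring
    have hle1 : t ^ (α / 2) ≤ 1 :=
      Real.rpow_le_one ht.1.le (ht.2.trans hT1) (by positivity)
    calc Real.sqrt t * ‖w t x‖
        = t ^ (α / 2) * (t ^ ((1 - α) / 2) * ‖w t x‖) := by
          rw [hsplit, mul_assoc]
      _ ≤ 1 * ε₁ :=
          mul_le_mul hle1 (hw t ht x) (mul_nonneg (Real.rpow_nonneg ht.1.le _) (norm_nonneg _))
            zero_le_one
      _ = ε₁ := one_mul _
  have hwT : ∀ {w : ℝ → UnitAddTorus (Fin 3) → EuclideanSpace ℝ (Fin 3)},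
      (∀ t ∈ Ioc (0 : ℝ) unitTime, ∀ x, t ^ ((1 - α) / 2) * ‖w t x‖ ≤ ε₁) →
      ∀ x, ‖w unitTime x‖ ≤ ε / 2 := by
    intro w hw x
    have h := (hw unitTime hTmem x).trans hε₁2
    rw [← hc, mul_comm (ε / 2) c] at h
    exact le_of_mul_le_mul_left h hc0
  -- triangle inequality pattern for the `Ḣ^{-1}` clauses
  have tri : ∀ {a b p q : UnitAddTorus (Fin 3) → EuclideanSpace ℝ (Fin 3)},
      Continuous a → Continuous b → Continuous p → Continuous q →
      Torus.eHomSobolevSeminorm (-1) (EuclideanSpace.complexify ∘ (a + p - (b + q))) ≤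
        Torus.eHomSobolevSeminorm (-1) (EuclideanSpace.complexify ∘ (a - b)) +
          (Torus.eHomSobolevSeminorm (-1) (EuclideanSpace.complexify ∘ p) +
            Torus.eHomSobolevSeminorm (-1) (EuclideanSpace.complexify ∘ q)) := by
    intro a b p q ha hb hp hq
    rw [← sub_add_sub_comm]
    exact (eHomSobolevSeminorm_complexify_add_le _ (ha.sub hb) (hp.sub hq)).trans
      (add_le_add le_rfl (eHomSobolevSeminorm_complexify_sub_le _ hp hq))
  -- agreement filters at `0⁺`
  have hI : Ioc (0 : ℝ) unitTime ∈ 𝓝[>] (0 : ℝ) := Ioc_mem_nhdsGT hT0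
  have hI2 : ∀ᶠ st in (𝓝[>] (0 : ℝ)) ×ˢ (𝓝[>] (0 : ℝ)),
      st.1 ∈ Ioc (0 : ℝ) unitTime ∧ st.2 ∈ Ioc (0 : ℝ) unitTime :=
    (eventually_of_mem hI fun t ht => ht).prod_mk (eventually_of_mem hI fun t ht => ht)
  refine ⟨unitTime, hT0, v₁ + w₁, v₂ + w₂, q₁, q₂, hu₁, hu₂, ⟨|K 0| + ε₁, fun t ht x => ?_⟩,
    ⟨t₀, ht₀, fun heq => ?_⟩, ?_, ?_, ?_, fun φ hφs hφm => ?_, ?_, ?_, fun x => ?_⟩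
  · -- Koch–Tataru bound on `(0, T_*]`
    simp only [Pi.add_apply]
    constructor
    · calc Real.sqrt t * ‖v₁ t x + w₁ t x‖
          ≤ Real.sqrt t * (‖v₁ t x‖ + ‖w₁ t x‖) := by gcongr; exact norm_add_le _ _
        _ = Real.sqrt t * ‖v₁ t x‖ + Real.sqrt t * ‖w₁ t x‖ := mul_add _ _ _
        _ ≤ |K 0| + ε₁ := add_le_add (h₁.sqrt_mul_norm_le ht x) (hwKT hw₁ t ht x)
    · calc Real.sqrt t * ‖v₂ t x + w₂ t x‖
          ≤ Real.sqrt t * (‖v₂ t x‖ + ‖w₂ t x‖) := by gcongr; exact norm_add_le _ _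
        _ = Real.sqrt t * ‖v₂ t x‖ + Real.sqrt t * ‖w₂ t x‖ := mul_add _ _ _
        _ ≤ |K 0| + ε₁ := add_le_add (h₂.sqrt_mul_norm_le ht x) (hwKT hw₂ t ht x)
  · -- distinct at `t₀`
    have hx : v₁ t₀ x₀ + w₁ t₀ x₀ = v₂ t₀ x₀ + w₂ t₀ x₀ := by
      simpa only [Pi.add_apply] using congrFun heq x₀
    have hvw : v₁ t₀ x₀ - v₂ t₀ x₀ = w₂ t₀ x₀ - w₁ t₀ x₀ := by
      rw [sub_eq_sub_iff_add_eq_add, hx, add_comm]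
    have hn : ‖v₁ t₀ x₀ - v₂ t₀ x₀‖ ≤ ‖w₂ t₀ x₀‖ + ‖w₁ t₀ x₀‖ := by
      rw [hvw]; exact norm_sub_le _ _
    have ht₀c : 0 ≤ t₀ ^ ((1 - α) / 2) := Real.rpow_nonneg ht₀.1.le _
    have key : 3 * ε₁ ≤ ε₁ + ε₁ :=
      calc 3 * ε₁ ≤ t₀ ^ ((1 - α) / 2) * ‖v₁ t₀ x₀ - v₂ t₀ x₀‖ := hdist
        _ ≤ t₀ ^ ((1 - α) / 2) * (‖w₂ t₀ x₀‖ + ‖w₁ t₀ x₀‖) := by gcongr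
        _ = t₀ ^ ((1 - α) / 2) * ‖w₂ t₀ x₀‖ + t₀ ^ ((1 - α) / 2) * ‖w₁ t₀ x₀‖ := mul_add _ _ _
        _ ≤ ε₁ + ε₁ := add_le_add (hw₂ t₀ ht₀ x₀) (hw₁ t₀ ht₀ x₀)
    linarith
  · -- common datum in `Ḣ^{-1}`
    have hlim : Tendsto (fun t =>
        Torus.eHomSobolevSeminorm (-1) (EuclideanSpace.complexify ∘ (v₁ t - v₂ t)) +
          (Torus.eHomSobolevSeminorm (-1) (EuclideanSpace.complexify ∘ w₁ t) +
            Torus.eHomSobolevSeminorm (-1) (EuclideanSpace.complexify ∘ w₂ t)))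
        (𝓝[>] 0) (𝓝 0) := by
      simpa using hdat.add (hH₁.add hH₂)
    refine tendsto_of_tendsto_of_tendsto_of_le_of_le' tendsto_const_nhds hlim
      (Eventually.of_forall fun t => zero_le) ?_
    filter_upwards [hI] with t ht
    simp only [Pi.add_apply]
    exact tri (hv₁c t ht) (hv₂c t ht) (hw₁c t ht) (hw₂c t ht)
  · -- `u₁(t)` Cauchy in `Ḣ^{-1}` as `t → 0⁺`
    have hlim : Tendsto (fun st : ℝ × ℝ =>
        Torus.eHomSobolevSeminorm (-1) (EuclideanSpace.complexify ∘ (v₁ st.1 - v₁ st.2)) +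
          (Torus.eHomSobolevSeminorm (-1) (EuclideanSpace.complexify ∘ w₁ st.1) +
            Torus.eHomSobolevSeminorm (-1) (EuclideanSpace.complexify ∘ w₁ st.2)))
        ((𝓝[>] (0 : ℝ)) ×ˢ (𝓝[>] (0 : ℝ))) (𝓝 0) := by
      simpa [Function.comp_def] using
        hc₁.add ((hH₁.comp tendsto_fst).add (hH₁.comp tendsto_snd))
    refine tendsto_of_tendsto_of_tendsto_of_le_of_le' tendsto_const_nhds hlim
      (Eventually.of_forall fun st => zero_le) ?_
    filter_upwards [hI2] with st hst
    simp only [Pi.add_apply]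
    exact tri (hv₁c _ hst.1) (hv₁c _ hst.2) (hw₁c _ hst.1) (hw₁c _ hst.2)
  · -- `u₂(t)` Cauchy in `Ḣ^{-1}` as `t → 0⁺`
    have hlim : Tendsto (fun st : ℝ × ℝ =>
        Torus.eHomSobolevSeminorm (-1) (EuclideanSpace.complexify ∘ (v₂ st.1 - v₂ st.2)) +
          (Torus.eHomSobolevSeminorm (-1) (EuclideanSpace.complexify ∘ w₂ st.1) +
            Torus.eHomSobolevSeminorm (-1) (EuclideanSpace.complexify ∘ w₂ st.2)))
        ((𝓝[>] (0 : ℝ)) ×ˢ (𝓝[>] (0 : ℝ))) (𝓝 0) := by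
      simpa [Function.comp_def] using
        hc₂.add ((hH₂.comp tendsto_fst).add (hH₂.comp tendsto_snd))
    refine tendsto_of_tendsto_of_tendsto_of_le_of_le' tendsto_const_nhds hlim
      (Eventually.of_forall fun st => zero_le) ?_
    filter_upwards [hI2] with st hst
    simp only [Pi.add_apply]
    exact tri (hv₂c _ hst.1) (hv₂c _ hst.2) (hw₂c _ hst.1) (hw₂c _ hst.2)
  · -- distributional pairings against smooth mean-zero test fields
    obtain ⟨c, hcv₁, hcv₂⟩ := hφ φ hφs hφm
    have hφc : Continuous φ := hφs.continuous
    have hadd : ∀ {v w : ℝ → UnitAddTorus (Fin 3) → EuclideanSpace ℝ (Fin 3)},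
        (∀ t ∈ Ioc (0 : ℝ) unitTime, Continuous (v t)) →
        (∀ t ∈ Ioc (0 : ℝ) unitTime, Continuous (w t)) →
        ∀ t ∈ Ioc (0 : ℝ) unitTime,
          ∫ x, ⟪(v + w) t x, φ x⟫ = (∫ x, ⟪v t x, φ x⟫) + ∫ x, ⟪w t x, φ x⟫ := by
      intro v w hv hw t ht
      simp only [Pi.add_apply, inner_add_left]
      exact integral_add (integrable_inner_of_continuous (hv t ht) hφc)
        (integrable_inner_of_continuous (hw t ht) hφc)
    have hu₁t : Tendsto (fun t => ∫ x, ⟪(v₁ + w₁) t x, φ x⟫) (𝓝[>] 0) (𝓝 c) := by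
      have h := hcv₁.add (hP₁ φ hφs hφm)
      rw [add_zero] at h
      refine h.congr' ?_
      filter_upwards [hI] with t ht
      exact (hadd hv₁c hw₁c t ht).symm
    have hu₂t : Tendsto (fun t => ∫ x, ⟪(v₂ + w₂) t x, φ x⟫) (𝓝[>] 0) (𝓝 c) := by
      have h := hcv₂.add (hP₂ φ hφs hφm)
      rw [add_zero] at h
      refine h.congr' ?_
      filter_upwards [hI] with t ht
      exact (hadd hv₂c hw₂c t ht).symm
    refine ⟨⟨c, hu₁t⟩, ⟨c, hu₂t⟩, ?_⟩
    have h := hu₁t.sub hu₂t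
    rw [sub_self] at h
    refine h.congr' ?_
    filter_upwards [hI] with t ht
    rw [← integral_sub
      (integrable_inner_of_continuous (hu₁.smooth_velocity.isSmooth_slice ht).continuous hφc)
      (integrable_inner_of_continuous (hu₂.smooth_velocity.isSmooth_slice ht).continuous hφc)]
    refine integral_congr_ae (Eventually.of_forall fun x => ?_)
    simp only [inner_sub_left]
  · -- zero mean of `u₁(T_*)`
    show ∫ x, (v₁ + w₁) unitTime x = 0
    simp only [Pi.add_apply]
    rw [integral_add
      ((hv₁c _ hTmem).integrable_of_hasCompactSupport (HasCompactSupport.of_compactSpace _))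
      ((hw₁c _ hTmem).integrable_of_hasCompactSupport (HasCompactSupport.of_compactSpace _))]
    have e1 : ∫ x, v₁ unitTime x = 0 := h₁.hasZeroMean _ hTmem
    have e2 : ∫ x, w₁ unitTime x = 0 := hm₁ _ hTmem
    rw [e1, e2, add_zero]
  · -- zero mean of `u₂(T_*)`
    show ∫ x, (v₂ + w₂) unitTime x = 0
    simp only [Pi.add_apply]
    rw [integral_add
      ((hv₂c _ hTmem).integrable_of_hasCompactSupport (HasCompactSupport.of_compactSpace _))
      ((hw₂c _ hTmem).integrable_of_hasCompactSupport (HasCompactSupport.of_compactSpace _))]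
    have e1 : ∫ x, v₂ unitTime x = 0 := h₂.hasZeroMean _ hTmem
    have e2 : ∫ x, w₂ unitTime x = 0 := hm₂ _ hTmem
    rw [e1, e2, add_zero]
  · -- smallness at `T_*`
    simp only [Pi.add_apply]
    exact ⟨(norm_add_le _ _).trans (by linarith [(hδ x).1, hwT hw₁ x]),
      (norm_add_le _ _).trans (by linarith [(hδ x).2, hwT hw₂ x])⟩

/-! ## The finite-time construction over the threshold form of the perturbation step -/

/-- **The finite-time construction from the principal parts and the CORRECTED perturbation step
(threshold form).** Hypothesis `hA` is verbatim the principal-parts hypothesis of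
`CoiculescuPalasek2025_construction_of_parts` (Def. 3.10, Prop. 3.13, Prop. 4.1 and the `v⁽ⁱ⁾`-only
estimates of §5: for every `α ∈ (0, 1/8)` SOME admissible Hölder exponent `κ₀ < 1/2 - 4α` and
constants `K, C`, then all smallness targets). Hypothesis `hB` is the perturbation step (Props.
4.2–4.3 with App. B and §5 ¶1) in the form its printed proof supports: for every `α ∈ (0, 1/8)`
and constants `K, C` there is a THRESHOLD `κ₁ > 0` such that for every Hölder exponent
`κ ∈ (0, κ₁]` there is `C₄ > 0` such that for all `ε₁ ∈ (0, C₄⁻¹)` some `ε₀, η > 0` make every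
approximate solution with data `(α, κ, K, C, η, ε₀)` correctable (five conclusions: classical
solution `v + w` on `(0, T_*]`, zero mean of `w`, `t^{(1-α)/2}‖w(t,x)‖ ≤ ε₁`, `‖w(t)‖_{Ḣ^{-1}} → 0`,
pairings with smooth mean-zero fields `→ 0`). In print `κ₁ = α` is a witness: with the semigroup
bound of Prop. 4.2 as proved (weight `t^{-(1+κ)/2}` on the `Ċ^{1,κ}` slot) the contraction of
Prop. 4.3 closes in `X` exactly when `κ ≤ α`, and the paper's `κ ∈ (0, 1/2 - 1/(2γ) - 2α)` (§4.1)
is free to be taken that small (§2.4). Conclusion: verbatim the hypothesis `h₁` of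
`CriticalDataSmoothNonuniqueness_of_parts`. Proof: `α = 1/16`; `κ₀, K, C` from `hA`, `κ₁` from `hB`;
every approximate solution with exponent `κ₀` is one with exponent `min κ₀ κ₁`
(`IsApproximateSolution.of_exponent_le`), so `construction_of_parts_at` applies at
`κ = min κ₀ κ₁ ≤ κ₁`. [cite: CoiculescuPalasek2025, §2.4, §4.1, Props. 4.2–4.3 and §5 (proof of Thm. 1.2)] -/
theorem CoiculescuPalasek2025_construction_of_parts_of_threshold
    (hA : ∀ α : ℝ, 0 < α → α < 1 / 8 →
      ∃ κ : ℝ≥0, 0 < κ ∧ (κ : ℝ) < 1 / 2 - 4 * α ∧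
      ∃ (K : ℕ → ℝ) (C : ℝ),
      ∀ (ε₀ η L δ : ℝ), 0 < ε₀ → 0 < η → 0 < δ →
      ∃ (v₁ v₂ : ℝ → UnitAddTorus (Fin 3) → EuclideanSpace ℝ (Fin 3))
        (F₁ F₂ : ℝ → UnitAddTorus (Fin 3) → (Fin 3 → Fin 3 → ℝ))
        (π₁ π₂ : ℝ → UnitAddTorus (Fin 3) → ℝ),
        IsApproximateSolution unitTime α κ K C η ε₀ v₁ F₁ π₁ ∧
        IsApproximateSolution unitTime α κ K C η ε₀ v₂ F₂ π₂ ∧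
        (∃ t₀ ∈ Ioc (0 : ℝ) unitTime, ∃ x₀ : UnitAddTorus (Fin 3),
          L ≤ t₀ ^ ((1 - α) / 2) * ‖v₁ t₀ x₀ - v₂ t₀ x₀‖) ∧
        Tendsto (fun t =>
            Torus.eHomSobolevSeminorm (-1) (EuclideanSpace.complexify ∘ (v₁ t - v₂ t)))
          (𝓝[>] 0) (𝓝 0) ∧
        Tendsto (fun st : ℝ × ℝ =>
            Torus.eHomSobolevSeminorm (-1) (EuclideanSpace.complexify ∘ (v₁ st.1 - v₁ st.2)))
          ((𝓝[>] (0 : ℝ)) ×ˢ (𝓝[>] (0 : ℝ))) (𝓝 0) ∧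
        Tendsto (fun st : ℝ × ℝ =>
            Torus.eHomSobolevSeminorm (-1) (EuclideanSpace.complexify ∘ (v₂ st.1 - v₂ st.2)))
          ((𝓝[>] (0 : ℝ)) ×ˢ (𝓝[>] (0 : ℝ))) (𝓝 0) ∧
        (∀ φ : UnitAddTorus (Fin 3) → EuclideanSpace ℝ (Fin 3), Torus.IsSmooth φ →
          Torus.HasZeroMean φ →
          ∃ c : ℝ, Tendsto (fun t => ∫ x, ⟪v₁ t x, φ x⟫) (𝓝[>] 0) (𝓝 c) ∧
            Tendsto (fun t => ∫ x, ⟪v₂ t x, φ x⟫) (𝓝[>] 0) (𝓝 c)) ∧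
        (∀ x, ‖v₁ unitTime x‖ ≤ δ ∧ ‖v₂ unitTime x‖ ≤ δ))
    (hB : ∀ α : ℝ, 0 < α → α < 1 / 8 → ∀ (K : ℕ → ℝ) (C : ℝ),
      ∃ κ₁ : ℝ≥0, 0 < κ₁ ∧ ∀ κ : ℝ≥0, 0 < κ → κ ≤ κ₁ →
      ∃ C₄ : ℝ, 0 < C₄ ∧
      ∀ ε₁ : ℝ, 0 < ε₁ → ε₁ < C₄⁻¹ →
      ∃ ε₀ : ℝ, 0 < ε₀ ∧ ∃ η : ℝ, 0 < η ∧
      ∀ (v : ℝ → UnitAddTorus (Fin 3) → EuclideanSpace ℝ (Fin 3))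
        (F : ℝ → UnitAddTorus (Fin 3) → (Fin 3 → Fin 3 → ℝ)) (π : ℝ → UnitAddTorus (Fin 3) → ℝ),
        IsApproximateSolution unitTime α κ K C η ε₀ v F π →
        ∃ (w : ℝ → UnitAddTorus (Fin 3) → EuclideanSpace ℝ (Fin 3))
          (q : ℝ → UnitAddTorus (Fin 3) → ℝ),
          Torus.IsClassicalNSSolutionOn (Ioc 0 unitTime) 1 0 (v + w) q ∧
          (∀ t ∈ Ioc (0 : ℝ) unitTime, Torus.HasZeroMean (w t)) ∧
          (∀ t ∈ Ioc (0 : ℝ) unitTime, ∀ x, t ^ ((1 - α) / 2) * ‖w t x‖ ≤ ε₁) ∧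
          Tendsto (fun t => Torus.eHomSobolevSeminorm (-1) (EuclideanSpace.complexify ∘ w t))
            (𝓝[>] 0) (𝓝 0) ∧
          ∀ φ : UnitAddTorus (Fin 3) → EuclideanSpace ℝ (Fin 3), Torus.IsSmooth φ →
            Torus.HasZeroMean φ → Tendsto (fun t => ∫ x, ⟪w t x, φ x⟫) (𝓝[>] 0) (𝓝 0)) :
    ∀ ε : ℝ, 0 < ε →
      ∃ T : ℝ, 0 < T ∧
      ∃ (u v : ℝ → UnitAddTorus (Fin 3) → EuclideanSpace ℝ (Fin 3))
        (p₁ p₂ : ℝ → UnitAddTorus (Fin 3) → ℝ),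
        Torus.IsClassicalNSSolutionOn (Ioc 0 T) 1 0 u p₁ ∧
        Torus.IsClassicalNSSolutionOn (Ioc 0 T) 1 0 v p₂ ∧
        (∃ M : ℝ, ∀ t ∈ Ioc (0 : ℝ) T, ∀ x,
          Real.sqrt t * ‖u t x‖ ≤ M ∧ Real.sqrt t * ‖v t x‖ ≤ M) ∧
        (∃ t₀ ∈ Ioc (0 : ℝ) T, u t₀ ≠ v t₀) ∧
        Tendsto (fun t =>
            Torus.eHomSobolevSeminorm (-1) (EuclideanSpace.complexify ∘ (u t - v t)))
          (𝓝[>] 0) (𝓝 0) ∧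
        Tendsto (fun st : ℝ × ℝ =>
            Torus.eHomSobolevSeminorm (-1) (EuclideanSpace.complexify ∘ (u st.1 - u st.2)))
          ((𝓝[>] (0 : ℝ)) ×ˢ (𝓝[>] (0 : ℝ))) (𝓝 0) ∧
        Tendsto (fun st : ℝ × ℝ =>
            Torus.eHomSobolevSeminorm (-1) (EuclideanSpace.complexify ∘ (v st.1 - v st.2)))
          ((𝓝[>] (0 : ℝ)) ×ˢ (𝓝[>] (0 : ℝ))) (𝓝 0) ∧
        (∀ φ : UnitAddTorus (Fin 3) → EuclideanSpace ℝ (Fin 3),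
          Torus.IsSmooth φ → Torus.HasZeroMean φ →
          (∃ c : ℝ, Tendsto (fun t => ∫ x, ⟪u t x, φ x⟫) (𝓝[>] 0) (𝓝 c)) ∧
          (∃ c : ℝ, Tendsto (fun t => ∫ x, ⟪v t x, φ x⟫) (𝓝[>] 0) (𝓝 c)) ∧
          Tendsto (fun t => ∫ x, ⟪u t x - v t x, φ x⟫) (𝓝[>] 0) (𝓝 0)) ∧
        Torus.HasZeroMean (u T) ∧ Torus.HasZeroMean (v T) ∧
        (∀ x, ‖u T x‖ ≤ ε ∧ ‖v T x‖ ≤ ε) := by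
  have hα : (0 : ℝ) < 1 / 16 := by norm_num
  have hα' : (1 / 16 : ℝ) < 1 / 8 := by norm_num
  obtain ⟨κ₀, hκ₀, -, K, C, hA⟩ := hA (1 / 16) hα hα'
  obtain ⟨κ₁, hκ₁, hB⟩ := hB (1 / 16) hα hα' K C
  refine construction_of_parts_at (κ := min κ₀ κ₁) (K := K) (C := C) hα
    (fun ε₀ η L δ hε₀ hη hδ => ?_) (hB (min κ₀ κ₁) (lt_min hκ₀ hκ₁) (min_le_right _ _))
  obtain ⟨v₁, v₂, F₁, F₂, π₁, π₂, h₁, h₂, hrest⟩ := hA ε₀ η L δ hε₀ hη hδ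
  exact ⟨v₁, v₂, F₁, F₂, π₁, π₂, h₁.of_exponent_le (min_le_left _ _),
    h₂.of_exponent_le (min_le_left _ _), hrest⟩

/-! ## The barrier fact over the corrected seam -/

/-- **The barrier fact from the principal parts and the corrected perturbation step (threshold
form).** `CriticalDataSmoothNonuniqueness` (Coiculescu–Palasek 2025, Thm. 1.2 with Rmk. 1.3 as
rendered) follows from the principal parts with their residuals (`hA`: Def. 3.10, Prop. 3.13,
Prop. 4.1, §5 — verbatim the hypothesis `hA` of
`CriticalDataSmoothNonuniqueness_of_principalParts_of_perturbation`) and the threshold form of the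
perturbation step (`hB`: Props. 4.2–4.3 for Hölder exponents below a positive threshold, see
`CoiculescuPalasek2025_construction_of_parts_of_threshold`): the finite-time construction is
`CoiculescuPalasek2025_construction_of_parts_of_threshold`, the global extension is the discharged
`CoiculescuPalasek2025_globalExtension_holds`, assembled by `CriticalDataSmoothNonuniqueness_of_parts`.
This replaces `CriticalDataSmoothNonuniqueness_of_principalParts_of_perturbation`, whose second
hypothesis is refuted (`not_CoiculescuPalasek2025_perturbation`).
[cite: CoiculescuPalasek2025, Def. 3.10, Prop. 3.13, Props. 4.1–4.3 and §5 (proof of Thm. 1.2)] -/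
theorem CriticalDataSmoothNonuniqueness_of_principalParts_of_perturbationThreshold
    (hA : ∀ α : ℝ, 0 < α → α < 1 / 8 →
      ∃ κ : ℝ≥0, 0 < κ ∧ (κ : ℝ) < 1 / 2 - 4 * α ∧
      ∃ (K : ℕ → ℝ) (C : ℝ),
      ∀ (ε₀ η L δ : ℝ), 0 < ε₀ → 0 < η → 0 < δ →
      ∃ (v₁ v₂ : ℝ → UnitAddTorus (Fin 3) → EuclideanSpace ℝ (Fin 3))
        (F₁ F₂ : ℝ → UnitAddTorus (Fin 3) → (Fin 3 → Fin 3 → ℝ))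
        (π₁ π₂ : ℝ → UnitAddTorus (Fin 3) → ℝ),
        IsApproximateSolution unitTime α κ K C η ε₀ v₁ F₁ π₁ ∧
        IsApproximateSolution unitTime α κ K C η ε₀ v₂ F₂ π₂ ∧
        (∃ t₀ ∈ Ioc (0 : ℝ) unitTime, ∃ x₀ : UnitAddTorus (Fin 3),
          L ≤ t₀ ^ ((1 - α) / 2) * ‖v₁ t₀ x₀ - v₂ t₀ x₀‖) ∧
        Tendsto (fun t =>
            Torus.eHomSobolevSeminorm (-1) (EuclideanSpace.complexify ∘ (v₁ t - v₂ t)))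
          (𝓝[>] 0) (𝓝 0) ∧
        Tendsto (fun st : ℝ × ℝ =>
            Torus.eHomSobolevSeminorm (-1) (EuclideanSpace.complexify ∘ (v₁ st.1 - v₁ st.2)))
          ((𝓝[>] (0 : ℝ)) ×ˢ (𝓝[>] (0 : ℝ))) (𝓝 0) ∧
        Tendsto (fun st : ℝ × ℝ =>
            Torus.eHomSobolevSeminorm (-1) (EuclideanSpace.complexify ∘ (v₂ st.1 - v₂ st.2)))
          ((𝓝[>] (0 : ℝ)) ×ˢ (𝓝[>] (0 : ℝ))) (𝓝 0) ∧
        (∀ φ : UnitAddTorus (Fin 3) → EuclideanSpace ℝ (Fin 3), Torus.IsSmooth φ →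
          Torus.HasZeroMean φ →
          ∃ c : ℝ, Tendsto (fun t => ∫ x, ⟪v₁ t x, φ x⟫) (𝓝[>] 0) (𝓝 c) ∧
            Tendsto (fun t => ∫ x, ⟪v₂ t x, φ x⟫) (𝓝[>] 0) (𝓝 c)) ∧
        (∀ x, ‖v₁ unitTime x‖ ≤ δ ∧ ‖v₂ unitTime x‖ ≤ δ))
    (hB : ∀ α : ℝ, 0 < α → α < 1 / 8 → ∀ (K : ℕ → ℝ) (C : ℝ),
      ∃ κ₁ : ℝ≥0, 0 < κ₁ ∧ ∀ κ : ℝ≥0, 0 < κ → κ ≤ κ₁ →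
      ∃ C₄ : ℝ, 0 < C₄ ∧
      ∀ ε₁ : ℝ, 0 < ε₁ → ε₁ < C₄⁻¹ →
      ∃ ε₀ : ℝ, 0 < ε₀ ∧ ∃ η : ℝ, 0 < η ∧
      ∀ (v : ℝ → UnitAddTorus (Fin 3) → EuclideanSpace ℝ (Fin 3))
        (F : ℝ → UnitAddTorus (Fin 3) → (Fin 3 → Fin 3 → ℝ)) (π : ℝ → UnitAddTorus (Fin 3) → ℝ),
        IsApproximateSolution unitTime α κ K C η ε₀ v F π →
        ∃ (w : ℝ → UnitAddTorus (Fin 3) → EuclideanSpace ℝ (Fin 3))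
          (q : ℝ → UnitAddTorus (Fin 3) → ℝ),
          Torus.IsClassicalNSSolutionOn (Ioc 0 unitTime) 1 0 (v + w) q ∧
          (∀ t ∈ Ioc (0 : ℝ) unitTime, Torus.HasZeroMean (w t)) ∧
          (∀ t ∈ Ioc (0 : ℝ) unitTime, ∀ x, t ^ ((1 - α) / 2) * ‖w t x‖ ≤ ε₁) ∧
          Tendsto (fun t => Torus.eHomSobolevSeminorm (-1) (EuclideanSpace.complexify ∘ w t))
            (𝓝[>] 0) (𝓝 0) ∧
          ∀ φ : UnitAddTorus (Fin 3) → EuclideanSpace ℝ (Fin 3), Torus.IsSmooth φ →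
            Torus.HasZeroMean φ → Tendsto (fun t => ∫ x, ⟪w t x, φ x⟫) (𝓝[>] 0) (𝓝 0)) :
    CriticalDataSmoothNonuniqueness :=
  CriticalDataSmoothNonuniqueness_of_parts
    (CoiculescuPalasek2025_construction_of_parts_of_threshold hA hB)
    CoiculescuPalasek2025_globalExtension_holds

/-- **The barrier fact from the principal parts and the corrected perturbation step (`κ ≤ α`
form).** As `CriticalDataSmoothNonuniqueness_of_principalParts_of_perturbationThreshold`, with
the perturbation step in the shape of the correction section of `…Construction`: the statement
of `CoiculescuPalasek2025_perturbation` (Props. 4.2–4.3 abstracted to approximate solutions) with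
the ADDITIONAL hypothesis `κ ≤ α` on the Hölder exponent (and only the five conclusions the
assembly consumes). This implies the threshold form with `κ₁ = min α (1/4 - 2α)` — any positive
number `≤ α` below `1/2 - 4α` (positive for `α < 1/8`). [cite: CoiculescuPalasek2025, Props. 4.2–4.3 and §5 (proof of Thm. 1.2)] -/
theorem CriticalDataSmoothNonuniqueness_of_principalParts_of_perturbationLe
    (hA : ∀ α : ℝ, 0 < α → α < 1 / 8 →
      ∃ κ : ℝ≥0, 0 < κ ∧ (κ : ℝ) < 1 / 2 - 4 * α ∧
      ∃ (K : ℕ → ℝ) (C : ℝ),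
      ∀ (ε₀ η L δ : ℝ), 0 < ε₀ → 0 < η → 0 < δ →
      ∃ (v₁ v₂ : ℝ → UnitAddTorus (Fin 3) → EuclideanSpace ℝ (Fin 3))
        (F₁ F₂ : ℝ → UnitAddTorus (Fin 3) → (Fin 3 → Fin 3 → ℝ))
        (π₁ π₂ : ℝ → UnitAddTorus (Fin 3) → ℝ),
        IsApproximateSolution unitTime α κ K C η ε₀ v₁ F₁ π₁ ∧
        IsApproximateSolution unitTime α κ K C η ε₀ v₂ F₂ π₂ ∧
        (∃ t₀ ∈ Ioc (0 : ℝ) unitTime, ∃ x₀ : UnitAddTorus (Fin 3),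
          L ≤ t₀ ^ ((1 - α) / 2) * ‖v₁ t₀ x₀ - v₂ t₀ x₀‖) ∧
        Tendsto (fun t =>
            Torus.eHomSobolevSeminorm (-1) (EuclideanSpace.complexify ∘ (v₁ t - v₂ t)))
          (𝓝[>] 0) (𝓝 0) ∧
        Tendsto (fun st : ℝ × ℝ =>
            Torus.eHomSobolevSeminorm (-1) (EuclideanSpace.complexify ∘ (v₁ st.1 - v₁ st.2)))
          ((𝓝[>] (0 : ℝ)) ×ˢ (𝓝[>] (0 : ℝ))) (𝓝 0) ∧
        Tendsto (fun st : ℝ × ℝ =>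
            Torus.eHomSobolevSeminorm (-1) (EuclideanSpace.complexify ∘ (v₂ st.1 - v₂ st.2)))
          ((𝓝[>] (0 : ℝ)) ×ˢ (𝓝[>] (0 : ℝ))) (𝓝 0) ∧
        (∀ φ : UnitAddTorus (Fin 3) → EuclideanSpace ℝ (Fin 3), Torus.IsSmooth φ →
          Torus.HasZeroMean φ →
          ∃ c : ℝ, Tendsto (fun t => ∫ x, ⟪v₁ t x, φ x⟫) (𝓝[>] 0) (𝓝 c) ∧
            Tendsto (fun t => ∫ x, ⟪v₂ t x, φ x⟫) (𝓝[>] 0) (𝓝 c)) ∧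
        (∀ x, ‖v₁ unitTime x‖ ≤ δ ∧ ‖v₂ unitTime x‖ ≤ δ))
    (hB : ∀ α : ℝ, 0 < α → α < 1 / 8 →
      ∀ κ : ℝ≥0, 0 < κ → (κ : ℝ) < 1 / 2 - 4 * α → (κ : ℝ) ≤ α →
      ∀ (K : ℕ → ℝ) (C : ℝ),
      ∃ C₄ : ℝ, 0 < C₄ ∧
      ∀ ε₁ : ℝ, 0 < ε₁ → ε₁ < C₄⁻¹ →
      ∃ ε₀ : ℝ, 0 < ε₀ ∧ ∃ η : ℝ, 0 < η ∧
      ∀ (v : ℝ → UnitAddTorus (Fin 3) → EuclideanSpace ℝ (Fin 3))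
        (F : ℝ → UnitAddTorus (Fin 3) → (Fin 3 → Fin 3 → ℝ)) (π : ℝ → UnitAddTorus (Fin 3) → ℝ),
        IsApproximateSolution unitTime α κ K C η ε₀ v F π →
        ∃ (w : ℝ → UnitAddTorus (Fin 3) → EuclideanSpace ℝ (Fin 3))
          (q : ℝ → UnitAddTorus (Fin 3) → ℝ),
          Torus.IsClassicalNSSolutionOn (Ioc 0 unitTime) 1 0 (v + w) q ∧
          (∀ t ∈ Ioc (0 : ℝ) unitTime, Torus.HasZeroMean (w t)) ∧
          (∀ t ∈ Ioc (0 : ℝ) unitTime, ∀ x, t ^ ((1 - α) / 2) * ‖w t x‖ ≤ ε₁) ∧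
          Tendsto (fun t => Torus.eHomSobolevSeminorm (-1) (EuclideanSpace.complexify ∘ w t))
            (𝓝[>] 0) (𝓝 0) ∧
          ∀ φ : UnitAddTorus (Fin 3) → EuclideanSpace ℝ (Fin 3), Torus.IsSmooth φ →
            Torus.HasZeroMean φ → Tendsto (fun t => ∫ x, ⟪w t x, φ x⟫) (𝓝[>] 0) (𝓝 0)) :
    CriticalDataSmoothNonuniqueness := by
  refine CriticalDataSmoothNonuniqueness_of_principalParts_of_perturbationThreshold hA
    fun α hα hα' K C => ?_
  -- threshold `κ₁ = min α (1/4 - 2α)`: positive, `≤ α`, and `< 1/2 - 4α`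
  have h14 : (0 : ℝ) < 1 / 4 - 2 * α := by linarith
  refine ⟨⟨min α (1 / 4 - 2 * α), le_min hα.le h14.le⟩, ?_, fun κ hκ hκle => ?_⟩
  · exact_mod_cast lt_min hα h14
  have hκR : (κ : ℝ) ≤ min α (1 / 4 - 2 * α) := by exact_mod_cast hκle
  exact hB α hα hα' κ hκ ((hκR.trans (min_le_right _ _)).trans_lt (by linarith))
    (hκR.trans (min_le_left _ _)) K C

end Literature.Barriers.NavierStokesRegularity
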